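import Mathlib
import HarnessLib
import Summits.HubbardSuperconductivity.HubbardSuperconductivity.Theorems.KLProgrammeKLRegimeTwoLegCurvatureConsts
import Summits.HubbardSuperconductivity.HubbardSuperconductivity.Theorems.KLProgrammeKLRegimeEngineV8DefsG8

/-!
# K3 ENGINE / engine-flow child — token #9′ of the v2 bundle: the RAISED absolute curve-jet table `klC4aJetC2` (k = 2 entry `1 ↦ 2^4`)
# with its package rows (plan g17 (R47r), KL STATUS l.3231; finding F2′ of lane c4a-1, kit j283075, memo HOME/hubbard-kl-c4a-1/C4A-PLAN.md §14/§14′)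

Cell `gate-hubbard-kl`, lane hubbard-kl-c4a-1 (g2).  `…TwoLegCurvatureConsts` (p1/c4a-1) is append-only and its `klC4aJetC 2 = 1` is registered text of
`KLRegimeEngineV17F2` v1, so the raise is a NEW NAME: `klC4aJetC2 k := if k ≤ 1 then 2^10 else if k = 2 then 2^4 else if k = 3 then 2^4 else 2^11`
(ONLY the `k = 2` entry moves).  Why: under the Leibniz architecture of the tube-tadpole theorem (`…C4aCoMovingJetsL1.norm_iteratedDeriv_tubeTadpole_le_of_L1_unif`:
sup of the chart-Jacobian jets × L¹ of the vertex's co-moving jets) the generic-angle `k = 2` bound at scale `n = 2` is `≈ 9.1·U²` at the van-Hove end of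
`klWindowC ± 3/80` — above the entry `1`, below `2^4`; the window is frozen public text (Δ27), so the constant moves.

* §1 the table, evaluation lemmas, `klC4aJetC_le_klC4aJetC2` (the raise is monotone), `klC4aJetC2_le_two_pow` (`≤ 2^26`: inside `klJetX_mul_le_klS6`'s window,
  so NO package knock-on);
* §2 the package rows `klJetX_mul_klC4aJetC2_le_klS6`, `klC4aJetC2_le_klEngGeo6_S(_div)`, `klC4aJetC2_le_klEngGeo7_S`, `klC4aJetC2_le_klEngGeo8_S(_div)`
  (what the (M)/(e) closers' `_GQ` forms take BY NAME);
* §3 `curveJetBar_klC4aJetC2_le_twoLegBar_klEng6`, `TwoLegCurveJetBound.raise_klC4aJetC2` (conclusion-side weakening for stub (C):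
  a bound at the v1 table implies the bound at the raised table) and the `(G6,Q6)` instance.

Definitions of real constants + arithmetic; nothing is asserted about the Hubbard model.  References: BGM 2006 §2.4 (2.36)/(2.42)
[cite: BenfattoGiulianiMastropietro2006].
-/

noncomputable section

namespace Summit.HubbardSuperconductivity.HubbardSuperconductivity.Theorems.KLRegimeSplit

set_option linter.dupNamespace false -- summit = problem name (single-conjunct summit), D-0017

open Real Literature.MathematicalPhysics.QuantumLattice Literature.Probability.LatticeModels
open Summit.HubbardSuperconductivity.HubbardSuperconductivity.Theorems.EngineV8

/-! ## §1 The raised table -/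

/-- **`klC4aJetC2 k`** — token #9′: C4a's ABSOLUTE curve-jet table with the `k = 2` entry raised `1 ↦ 2^4`:
`2^10` (k = 0, 1), `2^4` (k = 2), `2^4` (k = 3), `2^11` (k ≥ 4). -/
def klC4aJetC2 (k : ℕ) : ℝ :=
  if k ≤ 1 then 2 ^ 10 else if k = 2 then 2 ^ 4 else if k = 3 then 2 ^ 4 else 2 ^ 11

/-- `klC4aJetC2 0 = 2^10`. -/
@[simp] theorem klC4aJetC2_zero : klC4aJetC2 0 = 2 ^ 10 := by simp [klC4aJetC2]
/-- `klC4aJetC2 1 = 2^10`. -/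
@[simp] theorem klC4aJetC2_one : klC4aJetC2 1 = 2 ^ 10 := by simp [klC4aJetC2]
/-- `klC4aJetC2 2 = 2^4`. -/
@[simp] theorem klC4aJetC2_two : klC4aJetC2 2 = 2 ^ 4 := by simp [klC4aJetC2]
/-- `klC4aJetC2 3 = 2^4`. -/
@[simp] theorem klC4aJetC2_three : klC4aJetC2 3 = 2 ^ 4 := by simp [klC4aJetC2]
/-- `klC4aJetC2 4 = 2^11`. -/
@[simp] theorem klC4aJetC2_four : klC4aJetC2 4 = 2 ^ 11 := by simp [klC4aJetC2]
/-- `klC4aJetC2 k = 2^11` for `k ≥ 4`. -/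
theorem klC4aJetC2_of_four_le {k : ℕ} (hk : 4 ≤ k) : klC4aJetC2 k = 2 ^ 11 := by
  unfold klC4aJetC2; rw [if_neg (by omega), if_neg (by omega), if_neg (by omega)]

/-- `0 ≤ klC4aJetC2 k`. -/
theorem klC4aJetC2_nonneg (k : ℕ) : 0 ≤ klC4aJetC2 k := by
  unfold klC4aJetC2; split_ifs <;> positivity

/-- `1 ≤ klC4aJetC2 k`. -/
theorem one_le_klC4aJetC2 (k : ℕ) : 1 ≤ klC4aJetC2 k := by
  unfold klC4aJetC2; split_ifs <;> norm_num

/-- **The raise is monotone**: `klC4aJetC k ≤ klC4aJetC2 k` for every `k` (equality off `k = 2`). -/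
theorem klC4aJetC_le_klC4aJetC2 (k : ℕ) : klC4aJetC k ≤ klC4aJetC2 k := by
  unfold klC4aJetC klC4aJetC2; split_ifs <;> norm_num

/-- Off `k = 2` the two tables agree. -/
theorem klC4aJetC2_eq_klC4aJetC_of_ne_two {k : ℕ} (hk : k ≠ 2) : klC4aJetC2 k = klC4aJetC k := by
  unfold klC4aJetC klC4aJetC2; rw [if_neg hk, if_neg hk]

/-- **`klC4aJetC2 k ≤ 2^26`** — inside the sufficiency window of `klJetX_mul_le_klS6` (no package knock-on). -/
theorem klC4aJetC2_le_two_pow (k : ℕ) : klC4aJetC2 k ≤ 2 ^ 26 := by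
  unfold klC4aJetC2; split_ifs <;> norm_num

/-! ## §2 The package rows -/

/-- **`klJetX k · klC4aJetC2 k ≤ klS6 k`.** -/
theorem klJetX_mul_klC4aJetC2_le_klS6 (k : ℕ) : klJetX k * klC4aJetC2 k ≤ klS6 k :=
  klJetX_mul_le_klS6 (klC4aJetC2_nonneg k) (klC4aJetC2_le_two_pow k) k

/-- Divided form against the v6 geometric package: `klC4aJetC2 k ≤ klEngGeo6.S k / klJetX k`. -/
theorem klC4aJetC2_le_klEngGeo6_S_div (k : ℕ) : klC4aJetC2 k ≤ klEngGeo6.S k / klJetX k := by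
  rw [le_div_iff₀ (klJetX_pos k), mul_comm]
  exact (klJetX_mul_klC4aJetC2_le_klS6 k).trans (klS6_le_klEngGeo6_S k)

/-- `klC4aJetC2 k ≤ klEngGeo6.S k`. -/
theorem klC4aJetC2_le_klEngGeo6_S (k : ℕ) : klC4aJetC2 k ≤ klEngGeo6.S k := by
  have h1 := klJetX_mul_klC4aJetC2_le_klS6 k
  have h2 := klS6_le_klEngGeo6_S k
  have hx := one_le_klJetX k
  have hc := klC4aJetC2_nonneg k
  nlinarith

/-- Row A2 at the v7 package: `klC4aJetC2 k ≤ klEngGeo7.S k` (`klEngGeo7.S = klEngGeo6.S`, `rfl`). -/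
theorem klC4aJetC2_le_klEngGeo7_S (k : ℕ) : klC4aJetC2 k ≤ klEngGeo7.S k := by
  rw [klEngGeo7_S]; exact klC4aJetC2_le_klEngGeo6_S k

/-- **Row A2 at the v8 package (token #15)**: `klC4aJetC2 k ≤ klEngGeo8.S k` (`klEngGeo8.S = klEngGeo7.S`, `rfl`). -/
theorem klC4aJetC2_le_klEngGeo8_S (k : ℕ) : klC4aJetC2 k ≤ klEngGeo8.S k := by
  rw [klEngGeo8_S, klEngGeo7_S]; exact klC4aJetC2_le_klEngGeo6_S k

/-- Divided form at the v8 package: `klC4aJetC2 k ≤ klEngGeo8.S k / klJetX k`. -/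
theorem klC4aJetC2_le_klEngGeo8_S_div (k : ℕ) : klC4aJetC2 k ≤ klEngGeo8.S k / klJetX k := by
  rw [klEngGeo8_S, klEngGeo7_S]; exact klC4aJetC2_le_klEngGeo6_S_div k

/-! ## §3 The curve-jet bar at the raised table -/

/-- `curveJetBar klC4aJetC c′ U k n ≤ curveJetBar klC4aJetC2 c′ U k n` (the raise only weakens the bar). -/
theorem curveJetBar_klC4aJetC_le_klC4aJetC2 (c' : ℕ → ℝ) (U : ℝ) (k n : ℕ) :
    curveJetBar klC4aJetC c' U k n ≤ curveJetBar klC4aJetC2 c' U k n :=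
  curveJetBar_mono klC4aJetC_le_klC4aJetC2 (fun _ => le_rfl) U k n

/-- **`curveJetBar klC4aJetC2 (klC4aJetC′ P R) U k n ≤ twoLegBar klEngGeo6 (klEngQ6 P R) U k n`** for every `k, n, U`. -/
theorem curveJetBar_klC4aJetC2_le_twoLegBar_klEng6 (P : SplitConsts) (R : RenConsts) (U : ℝ) (k n : ℕ) :
    curveJetBar klC4aJetC2 (klC4aJetC' P R) U k n ≤ twoLegBar klEngGeo6 (klEngQ6 P R) U k n := by
  rw [← curveJetBar_eq_twoLegBar]
  exact curveJetBar_mono (fun k => klC4aJetC2_le_klEngGeo6_S k) (fun k => klC4aJetC'_le_klEngQ6_S' P R k) U k n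

section Model

variable {L M : ℕ} [NeZero L] [NeZero M]

/-- **Conclusion-side weakening for stub (C)**: a curve-jet bound at the v1 table `klC4aJetC` gives the bound at the raised table `klC4aJetC2`. -/
theorem TwoLegCurveJetBound.raise_klC4aJetC2 {c' : ℕ → ℝ} {β U μ : ℝ} {K : TrigPolyC4v} {n : ℕ}
    (h : TwoLegCurveJetBound L M klC4aJetC c' β U μ K n) : TwoLegCurveJetBound L M klC4aJetC2 c' β U μ K n :=
  h.mono klC4aJetC_le_klC4aJetC2 (fun _ => le_rfl)

/-- **The raised table feeds the `(G6, Q6)` instance**: `TwoLegCurveJetBound … klC4aJetC2 (klC4aJetC′ P R) … n → TwoLegCurveJetBoundGQ … klEngGeo6 (klEngQ6 P R) … n`. -/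
theorem twoLegCurveJetBoundGQ_klEng6_of_klC4aJetC2 {P : SplitConsts} {R : RenConsts} {β U μ : ℝ} {K : TrigPolyC4v} {n : ℕ}
    (h : TwoLegCurveJetBound L M klC4aJetC2 (klC4aJetC' P R) β U μ K n) :
    TwoLegCurveJetBoundGQ L M klEngGeo6 (klEngQ6 P R) β U μ K n :=
  ⟨h.1, fun k hk θ => (h.2 k hk θ).trans (curveJetBar_klC4aJetC2_le_twoLegBar_klEng6 P R U k n)⟩

end Model

end Summit.HubbardSuperconductivity.HubbardSuperconductivity.Theorems.KLRegimeSplit
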